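import Mathlib
import Literature.MathematicalPhysics.QuantumFieldTheory.Balaban1983to89.Beta.OneLoop
import Literature.MathematicalPhysics.QuantumFieldTheory.Balaban1983to89.B12Sec2to5

/-!
# `Balaban1983to89.Beta.InfiniteVolume` — the limit `T ↗ ℤ^d` behind (1.21)–(1.22) of [Balaban1987RG1]:
# the finite-torus second moment converges to the `ℤ^d` second moment under volume-uniform (5.10)-type decay

T. Bałaban, *Renormalization group approach to lattice gauge field theories. I. Generation of effective actions in a
small field approximation and a coupling constant renormalization in four dimensions*, Commun. Math. Phys. **109**,
249–301 (1987) [Balaban1987RG1] (cell paper B12; PDF page = journal page − 248; PDF held: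
`paper:balaban1987-cmp109-rg-i-small-field`).

CITATION HEADER (lean-in-tree rule 2026-08-18).  This module is KERNEL-CHECKED BOOKKEEPING about lattice sums, written
for the β sub-cell of the Bałaban YM₄ reconstruction (unit `b2b-balaban-pv01` gen 3, journal node
`G-beta-4-VOLLIM-KERNEL`; cell records `HOME/GAPS.md` G-beta-4 (beta-ref), `HOME/BETA/OBJECTS.md` §5(d) (pv25)).  It sits
between two LANDED modules and touches neither: `…Beta.OneLoop` (pv25: the torus objects `Site`, `symmRep`,
`torusSecondMoment`, `torusKernel`, `torusBetaZero`, the limit predicate `IsInfiniteVolumeLimit` and the hypothesis carrier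
`OneLoopDictionary`) and `…B12Sec2to5` (b03: `l1`, `Decay510` = (5.10) for one component kernel, `majorant_summable`,
`secondMoment_abs_le_of_decay510`, `betaPrime510`), over `B12Beta.secondMoment` = the right member of (1.22).

THE PRINTED TEXT THIS MODULE IS ABOUT (verbatim, from the 300-dpi renders `1987-cmp109-rg-I-small-field-pNNN-x2.png`,
NNN ∈ {003, 016, 044, 045}, under `HOME/b2b-balaban-ref1/pages/1987-cmp109-rg-I-small-field/`):
* p. 251 [PDF 3]: *"… or a torus T obtained by the usual identification of boundary points of the cube
  {x ∈ R^d : −L_μ ≤ x_μ ≤ L_μ, μ = 1, …, d}. We take L_μ = L^m, where L is an odd, positive integer > 11, and m is a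
  positive integer."* and **(0.1)** *"T_ε = {x ∈ εZ^d + Σ_{μ=1}^d ½εe_μ : −L_μ < x_μ < L_μ, μ = 1, …, d}, (0.1) with a
  lattice spacing ε = L^{−K}. This torus determines a sequence of tori denoted by T^{(k)}_{L^kε} and defined by (0.1)
  with ε replaced by L^kε, k = 1, 2, … ."*
* p. 264 [PDF 16], after **(1.21)**: *"Now we take a limit of these functions as T^{(j+1)} ↗ Z^d. This limit exists by
  the localized representation (1.7)."* and **(1.22)**: *"The function β_{j+1}(g_j) is defined by … =
  Σ_x Π_{j+1,μν}(g_j, x) x_μ x_ν (1.22) for μ, ν arbitrary, μ ≠ ν"* (typed: `B12Beta.secondMoment`).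
* p. 292 [PDF 44], **(5.1)**: *"Π(b, b′) = lim_{T_1^{(j)} ↗ Z^4} δ²/δB(b)δB(b′) E^{(j)}(U_j(exp iB))|_{B=0}."*
* p. 293 [PDF 45], **(5.10)**: *"The representation (4.37) yields the following inequality |Π_{μν}(x − y)| ≦ O(1)E₀
  exp(−δ₁|x − y|), (5.10) with a positive constant δ₁ determined by δ₀, κ, and M (e.g., δ₁ = 1/2min{δ₀, κM⁻¹})."*
  (typed: `B12Sec2to5.Decay510`) and after **(5.11)**: *"By the inequality (5.10) it can be extended as an analytic
  function to complex variables ζ_μ = p_μ + iq_μ, |q_μ| < δ₁. This property is the basic reason why we have taken the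
  infinite volume limit in (5.1)."*

WHAT IS PROVED HERE (every `theorem` kernel-checked; elementary analysis, no physics):
* Part 1 — WINDOW BOOKKEEPING.  The symmetric representative `Beta.symmRep s : ZMod s → ℤ` (pv25) is a bijection of
  `ZMod s` onto the integer window `]−s/2, s/2]` (`InWindow s`), inverse to the residue map (`intCast_symmRep`,
  `symmRep_intCast`); coordinatewise this identifies the torus `Site d s = (ZMod s)^d` with the window cube of `ℤ^d`
  (`windowMap`, `siteOf`), and the finite-volume second moment `Beta.torusSecondMoment P μ ν` (pv25's torus proxy for
  (1.22)) IS the (1.22)-functional `B12Beta.secondMoment` of the kernel extended by zero off the window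
  (`windowKernel`, `torusSecondMoment_eq_secondMoment_windowKernel`).
* Part 2 — THE LIMIT `T ↗ ℤ^d` AT A FIXED SCALE (dominated convergence on exhausting tori = Tannery's theorem,
  `tendsto_tsum_of_dominated_convergence`).  HYPOTHESES: torus kernels `P t` on sides `side t → ∞`, a pointwise limit
  kernel `Pinf` on `ℤ^d` in the sense of pv25's `Beta.IsInfiniteVolumeLimit` (the EXISTENCE statement of p. 264, which
  print justifies in one sentence by "(1.7)" — GAPS G-adv2-2; a hypothesis here), and the decay (5.10) asked of the
  FINITE-VOLUME kernels with constants `C, δ` INDEPENDENT OF THE VOLUME (`UniformDecay` — see its docstring: this is the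
  located UNPRINTED input of GAPS G-beta-4; (5.10) is printed for the limit kernel only; carried as a hypothesis, never
  asserted).  CONCLUSIONS: the limit kernel obeys (5.10) with the same constants (`decay510_of_isInfiniteVolumeLimit`);
  the torus second moments converge to the (1.22) second moment of the limit kernel (`tendsto_torusSecondMoment`); both
  are bounded by b03's `betaPrime510 d C δ` (`abs_torusSecondMoment_le`, `abs_secondMoment_lim_le`); and an eventual
  one-sided bound on the torus numbers passes to the limit (`le_secondMoment_lim_of_eventually`).
* Part 3 — THE DICTIONARY COROLLARY.  For pv25's hypothesis carrier `D : Beta.OneLoopDictionary d c S` (whose fields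
  `isLimit` / `beta0_eq` are exactly (1.21) / (1.22) for the one-loop part), at a scale `k` whose torus sides
  `D.side k t → ∞`, volume-uniform decay of the torus kernels at one colour `a` gives: row num's finite-volume observable
  `Beta.torusBetaZero (D.model k t) a μ ν` CONVERGES to the abstract one-loop coefficient `S.β0 k` (`μ ≠ ν`)
  (`OneLoopDictionary.tendsto_torusBetaZero`), `|S.β0 k| ≤ betaPrime510 d C δ` (`OneLoopDictionary.abs_beta0_le`), and
  a lower bound valid on all sufficiently large tori is a lower bound for `S.β0 k` (`OneLoopDictionary.le_beta0_of_eventually`)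
  — the logical shape of the finite list (AF-0s) «S.β0 k ≥ 3β⁰_∞/4, k < k₀» consumed by
  `FlowStepRuns.betaLowerH_of_limitSplit`.  A QUANTITATIVE version (an explicit finite-volume error from an explicit
  convergence RATE, which is what certifying (AF-0s) from ONE finite torus requires) is deliberately NOT here: it is the
  sibling node of unit `b2b-balaban-pv04` gen 3 (journal 2026-08-18T18:01:14Z / 18:04:06Z).

HONEST FRAMING.  Nothing in this file asserts anything about Bałaban's kernels: the existence of the limit (1.21), the
decay (5.10) and its volume-uniform finite-torus version, the regularity making `torusKernel` a genuine Hessian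
(`OneLoopDictionary.smooth`, referee G-beta-7) and the trace-orthonormal coordinate convention (`OneLoopDictionary.model`
docstring) all remain OBLIGATIONS OF WHOEVER INSTANTIATES the dictionary.  No sign of any β-coefficient is claimed.  The β
sub-cell as a whole would, if completed, make the cell's UV-stability bookkeeping unconditional in its flow input — that is
NOT the continuum limit, NOT a mass gap, NOT the Clay problem.  Value = kernel bookkeeping for the bridge between row num's
torus numbers and the (1.22) coefficient, NOT summit progress.

DIVERGENCE (cell record D-pv01.7).  Print's unit torus at scale k has, per direction, the 2L_μ = 2L^m half-integer
points of (0.1) — an EVEN period; a translation-invariant kernel is a function of site differences, i.e. of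
`(ZMod (2L^m))^d`, which is pv25's relabelled `Site d s`.  The window `]−s/2, s/2]` used here (forced by pv25's
`symmRep`) is, for even `s`, asymmetric by the single point `s/2`; for the limit statements this is immaterial (every
fixed `x ∈ ℤ^d` is eventually interior).  The lattice distance of (5.10) is unspecified in print; `B12Sec2to5.l1` (ℓ¹) is
used, as in b03's module (D-b03.4).
-/

namespace Literature.MathematicalPhysics.QuantumFieldTheory.Balaban1983to89.Beta

open Literature.MathematicalPhysics.QuantumFieldTheory.Balaban1983to89
open _root_.Filter
open scoped _root_.Topology

/-! ## Part 1 — the symmetric window `]−s/2, s/2]` and the torus ↔ window dictionary -/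

/-- Membership of an integer `z` in the symmetric window `]−s/2, s/2]` of residues mod `s` — the range of pv25's
`symmRep s`; for print's odd periods this is the cube `−L_μ ≤ x_μ ≤ L_μ` of p. 251, for the even unit-lattice periods
`2L^m` of (0.1) it contains the one extra point `s/2` (module docstring, DIVERGENCE). [cite: Balaban1987RG1, (0.1) p.251] -/
def InWindow (s : ℕ) (z : ℤ) : Prop := -(s : ℤ) < 2 * z ∧ 2 * z ≤ s

/-- `InWindow s z` is decidable (it is a conjunction of integer inequalities). [folklore] -/
instance InWindow.instDecidable (s : ℕ) (z : ℤ) : Decidable (InWindow s z) :=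
  inferInstanceAs (Decidable (-(s : ℤ) < 2 * z ∧ 2 * z ≤ s))

/-- `symmRep s z` lies in the window `]−s/2, s/2]`. [folklore] -/
theorem inWindow_symmRep (s : ℕ) [NeZero s] (z : ZMod s) : InWindow s (symmRep s z) := by
  have hs : 0 < s := Nat.pos_of_ne_zero (NeZero.ne s)
  have hv : z.val < s := ZMod.val_lt z
  unfold symmRep InWindow
  split_ifs with h <;> constructor <;> omega

/-- `|symmRep s z| ≤ s/2`, in the integer form `2·|symmRep s z| ≤ s`. [folklore] -/
theorem two_mul_abs_symmRep_le (s : ℕ) [NeZero s] (z : ZMod s) : 2 * |symmRep s z| ≤ s := by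
  obtain ⟨h₁, h₂⟩ := inWindow_symmRep s z
  rcases abs_cases (symmRep s z) with ⟨h, _⟩ | ⟨h, _⟩ <;> omega

/-- The symmetric representative IS a representative: `(symmRep s z : ZMod s) = z`. [folklore] -/
theorem intCast_symmRep (s : ℕ) [NeZero s] (z : ZMod s) : ((symmRep s z : ℤ) : ZMod s) = z := by
  unfold symmRep
  split_ifs with h
  · rw [Int.cast_natCast, ZMod.natCast_zmod_val]
  · rw [Int.cast_sub, Int.cast_natCast, Int.cast_natCast, ZMod.natCast_zmod_val, ZMod.natCast_self, sub_zero]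

/-- Two integers of the window with the same residue mod `s` are equal (the window has fewer than `s` consecutive…
more precisely, any two of its points differ by less than `s`). [folklore] -/
theorem eq_of_inWindow_of_intCast_eq {s : ℕ} {a b : ℤ} (ha : InWindow s a) (hb : InWindow s b)
    (h : (a : ZMod s) = (b : ZMod s)) : a = b := by
  have hdvd : (s : ℤ) ∣ b - a := (ZMod.intCast_eq_intCast_iff_dvd_sub a b s).mp h
  obtain ⟨ha₁, ha₂⟩ := ha
  obtain ⟨hb₁, hb₂⟩ := hb
  have hzero : b - a = 0 := Int.eq_zero_of_abs_lt_dvd hdvd (abs_lt.mpr ⟨by omega, by omega⟩)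
  omega

/-- On the window, `symmRep` inverts the residue map: `symmRep s (z : ZMod s) = z` for `z ∈ ]−s/2, s/2]`. [folklore] -/
theorem symmRep_intCast {s : ℕ} [NeZero s] {z : ℤ} (h : InWindow s z) : symmRep s (z : ZMod s) = z :=
  eq_of_inWindow_of_intCast_eq (inWindow_symmRep s _) h (intCast_symmRep s _)

/-- A fixed integer is in the window of every sufficiently large period: `2|z| < s ⇒ z ∈ ]−s/2, s/2]`. [folklore] -/
theorem inWindow_of_two_mul_abs_lt {s : ℕ} {z : ℤ} (h : 2 * |z| < s) : InWindow s z := by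
  have h₁ := le_abs_self z
  have h₂ := neg_abs_le z
  constructor <;> omega

/-- The window coordinates of a torus site: `x ↦ (symmRep s (x i))_i ∈ ℤ^d`. [folklore] -/
def windowMap (d s : ℕ) [NeZero s] (x : Site d s) : Fin d → ℤ := fun i => symmRep s (x i)

/-- The torus site of a point of `ℤ^d` (coordinatewise residues). [folklore] -/
def siteOf (d s : ℕ) (y : Fin d → ℤ) : Site d s := fun i => (y i : ZMod s)

/-- `siteOf ∘ windowMap = id`. [folklore] -/
theorem siteOf_windowMap (d s : ℕ) [NeZero s] (x : Site d s) : siteOf d s (windowMap d s x) = x :=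
  funext fun i => intCast_symmRep s (x i)

/-- `windowMap ∘ siteOf = id` on the window cube. [folklore] -/
theorem windowMap_siteOf (d s : ℕ) [NeZero s] {y : Fin d → ℤ} (h : ∀ i, InWindow s (y i)) :
    windowMap d s (siteOf d s y) = y :=
  funext fun i => symmRep_intCast (h i)

/-- Window coordinates lie in the window. [folklore] -/
theorem inWindow_windowMap {d s : ℕ} [NeZero s] (x : Site d s) (i : Fin d) : InWindow s (windowMap d s x i) :=
  inWindow_symmRep s (x i)

/-- The window map is injective (the torus has exactly one site per window point). [folklore] -/
theorem windowMap_injective (d s : ℕ) [NeZero s] : Function.Injective (windowMap d s) := by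
  intro x x' h
  rw [← siteOf_windowMap d s x, ← siteOf_windowMap d s x', h]

/-- Extension by zero off the window: a function on the torus `Site d s` read as a function on `ℤ^d` supported in the
window cube (value `f (siteOf y)` on the window, `0` outside). [folklore] -/
noncomputable def windowExt {d s : ℕ} [NeZero s] (f : Site d s → ℝ) (y : Fin d → ℤ) : ℝ :=
  if (∀ i, InWindow s (y i)) then f (siteOf d s y) else 0

/-- Value of the extension on the window. [folklore] -/
theorem windowExt_of_inWindow {d s : ℕ} [NeZero s] (f : Site d s → ℝ) {y : Fin d → ℤ}
    (h : ∀ i, InWindow s (y i)) : windowExt f y = f (siteOf d s y) :=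
  if_pos h

/-- Value of the extension off the window. [folklore] -/
theorem windowExt_of_not_inWindow {d s : ℕ} [NeZero s] (f : Site d s → ℝ) {y : Fin d → ℤ}
    (h : ¬ ∀ i, InWindow s (y i)) : windowExt f y = 0 :=
  if_neg h

/-- The extension restricted along the window map is the original function. [folklore] -/
theorem windowExt_windowMap {d s : ℕ} [NeZero s] (f : Site d s → ℝ) (x : Site d s) :
    windowExt f (windowMap d s x) = f x := by
  rw [windowExt_of_inWindow f (inWindow_windowMap x), siteOf_windowMap]

/-- The extension is supported in the image of the window map. [folklore] -/
theorem support_windowExt_subset {d s : ℕ} [NeZero s] (f : Site d s → ℝ) :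
    Function.support (windowExt f) ⊆ Set.range (windowMap d s) := by
  intro y hy
  by_cases h : ∀ i, InWindow s (y i)
  · exact ⟨siteOf d s y, windowMap_siteOf d s h⟩
  · exact absurd (windowExt_of_not_inWindow f h) hy

/-- Pointwise domination of the extension: `|windowExt f y| ≤ |f (siteOf y)|`. [folklore] -/
theorem abs_windowExt_le {d s : ℕ} [NeZero s] (f : Site d s → ℝ) (y : Fin d → ℤ) :
    |windowExt f y| ≤ |f (siteOf d s y)| := by
  by_cases h : ∀ i, InWindow s (y i)
  · rw [windowExt_of_inWindow f h]
  · rw [windowExt_of_not_inWindow f h, abs_zero]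
    exact abs_nonneg _

/-- RE-INDEXING: a finite torus sum is the `ℤ^d`-sum (`tsum`) of the zero extension. [folklore] -/
theorem sum_eq_tsum_windowExt {d s : ℕ} [NeZero s] (f : Site d s → ℝ) :
    ∑ x : Site d s, f x = ∑' y : Fin d → ℤ, windowExt f y := by
  calc ∑ x : Site d s, f x = ∑ x : Site d s, windowExt f (windowMap d s x) := by
        simp only [windowExt_windowMap]
    _ = ∑' x : Site d s, windowExt f (windowMap d s x) := (tsum_fintype _).symm
    _ = ∑' y : Fin d → ℤ, windowExt f y := (windowMap_injective d s).tsum_eq (support_windowExt_subset f)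

/-- The torus kernel read as a kernel on `ℤ^d` (zero off the window): the object whose (1.22)-functional is the torus
proxy, see `torusSecondMoment_eq_secondMoment_windowKernel`. [cite: Balaban1987RG1, (1.21) p.264] -/
noncomputable def windowKernel {d s : ℕ} [NeZero s] (P : Fin d → Fin d → Site d s → ℝ) : B12Beta.Kernel d :=
  fun μ ν => windowExt (P μ ν)

/-- The weights `x_μ x_ν` commute with the extension: on the window the symmetric representatives of `siteOf y` are the
coordinates of `y`. [folklore] -/
theorem windowExt_mul_coord {d s : ℕ} [NeZero s] (P : Site d s → ℝ) (μ ν : Fin d) (y : Fin d → ℤ) :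
    windowExt (fun x => P x * (symmRep s (x μ) : ℝ) * (symmRep s (x ν) : ℝ)) y =
      windowExt P y * (y μ : ℝ) * (y ν : ℝ) := by
  by_cases h : ∀ i, InWindow s (y i)
  · rw [windowExt_of_inWindow _ h, windowExt_of_inWindow _ h]
    have hμ : symmRep s (siteOf d s y μ) = y μ := symmRep_intCast (h μ)
    have hν : symmRep s (siteOf d s y ν) = y ν := symmRep_intCast (h ν)
    rw [hμ, hν]
  · rw [windowExt_of_not_inWindow _ h, windowExt_of_not_inWindow _ h, zero_mul, zero_mul]

/-- **The torus proxy is the (1.22)-functional of the window kernel** (as a `tsum` over `ℤ^d`). [folklore] -/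
theorem torusSecondMoment_eq_tsum {d s : ℕ} [NeZero s] (P : Fin d → Fin d → Site d s → ℝ) (μ ν : Fin d) :
    torusSecondMoment P μ ν = ∑' y : Fin d → ℤ, windowKernel P μ ν y * (y μ : ℝ) * (y ν : ℝ) := by
  unfold torusSecondMoment
  rw [sum_eq_tsum_windowExt]
  exact tsum_congr fun y => windowExt_mul_coord (P μ ν) μ ν y

/-- `torusSecondMoment P μ ν = B12Beta.secondMoment (windowKernel P) μ ν` — the finite-volume second moment of pv25 is
LITERALLY the right member of (1.22) p. 264 evaluated on the zero-extended torus kernel. [cite: Balaban1987RG1, (1.22) p.264] -/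
theorem torusSecondMoment_eq_secondMoment_windowKernel {d s : ℕ} [NeZero s]
    (P : Fin d → Fin d → Site d s → ℝ) (μ ν : Fin d) :
    torusSecondMoment P μ ν = B12Beta.secondMoment (windowKernel P) μ ν :=
  torusSecondMoment_eq_tsum P μ ν

/-- Site-wise (5.10)-type decay on the torus (in the window distance) gives b03's `Decay510` for the window kernel, with
the same constants (`C ≥ 0` is needed only off the window, where the kernel is `0`). [folklore] -/
theorem decay510_windowKernel {d s : ℕ} [NeZero s] {P : Fin d → Fin d → Site d s → ℝ} {C δ : ℝ} (hC : 0 ≤ C)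
    {μ ν : Fin d} (h : ∀ x : Site d s, |P μ ν x| ≤ C * Real.exp (-δ * B12Sec2to5.l1 (windowMap d s x))) :
    B12Sec2to5.Decay510 (windowKernel P μ ν) C δ := by
  intro y
  by_cases hy : ∀ i, InWindow s (y i)
  · have h' := h (siteOf d s y)
    rw [windowMap_siteOf d s hy] at h'
    show |windowExt (P μ ν) y| ≤ _
    rwa [windowExt_of_inWindow _ hy]
  · show |windowExt (P μ ν) y| ≤ _
    rw [windowExt_of_not_inWindow _ hy, abs_zero]
    exact mul_nonneg hC (Real.exp_pos _).le

/-- FINITE-VOLUME §5 BOUND: under (5.10)-type decay of the window kernel, `|Σ_{x∈T} P_{μν}(x) x_μ x_ν| ≤ β′ =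
C·Σ_{x∈ℤ^d}|x|₁²e^{−δ|x|₁}` (b03's `betaPrime510`), for every volume. [folklore] -/
theorem abs_torusSecondMoment_le {d s : ℕ} [NeZero s] {P : Fin d → Fin d → Site d s → ℝ} {C δ : ℝ} (hδ : 0 < δ)
    {μ ν : Fin d} (h : B12Sec2to5.Decay510 (windowKernel P μ ν) C δ) :
    |torusSecondMoment P μ ν| ≤ B12Sec2to5.betaPrime510 d C δ := by
  rw [torusSecondMoment_eq_secondMoment_windowKernel]
  exact (B12Sec2to5.secondMoment_abs_le_of_decay510 hδ h).2

/-! ## Part 2 — the limit `T ↗ ℤ^d` at a fixed scale (dominated convergence on exhausting tori) -/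

/-- **THE LOCATED UNPRINTED INPUT of GAPS G-beta-4, as a hypothesis.**  (5.10) p. 293 is printed for the INFINITE-VOLUME
kernel `Π` of (5.1) (itself defined as the limit `T_1^{(j)} ↗ Z^4`); what the passage (1.21) → (1.22) p. 264 needs in
addition, to identify the `ℤ^d`-sum (1.22) with the limit of the torus sums, is the same exponential bound for the
FINITE-TORUS kernels `P t` with constants `C, δ` independent of the volume index `t` (distance = ℓ¹ size of the window
coordinates).  Print's mechanism for (5.10) — "The representation (4.37) yields" it from the inductive bound (1.18), whose
constants do not depend on the volume — makes this plausible; it is NOT printed and NOT asserted here.  A `Prop`, used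
only to the left of `→`. [cite: Balaban1987RG1, (5.10) p.293] -/
def UniformDecay {d : ℕ} (side : ℕ → ℕ) [∀ t, NeZero (side t)]
    (P : (t : ℕ) → Fin d → Fin d → Site d (side t) → ℝ) (C δ : ℝ) : Prop :=
  ∀ (t : ℕ) (μ ν : Fin d) (x : Site d (side t)),
    |P t μ ν x| ≤ C * Real.exp (-δ * B12Sec2to5.l1 (windowMap d (side t) x))

section Limit

variable {d : ℕ} {side : ℕ → ℕ} [∀ t, NeZero (side t)]
  {P : (t : ℕ) → Fin d → Fin d → Site d (side t) → ℝ} {Pinf : B12Beta.Kernel d} {C δ : ℝ}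

/-- The constant of a uniform decay bound is `≥ 0` as soon as there is a direction (read the bound at the origin).
[folklore] -/
theorem UniformDecay.nonneg (hdec : UniformDecay side P C δ) (μ ν : Fin d) : 0 ≤ C := by
  have h := hdec 0 μ ν (siteOf d (side 0) 0)
  have h0 : windowMap d (side 0) (siteOf d (side 0) (0 : Fin d → ℤ)) = 0 :=
    windowMap_siteOf d (side 0) fun i => inWindow_of_two_mul_abs_lt (by
      have := Nat.pos_of_ne_zero (NeZero.ne (side 0))
      simp only [Pi.zero_apply, abs_zero, mul_zero]
      exact_mod_cast this)
  rw [h0] at h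
  have hl : B12Sec2to5.l1 (0 : Fin d → ℤ) = 0 := by simp [B12Sec2to5.l1]
  rw [hl, mul_zero, Real.exp_zero, mul_one] at h
  exact (abs_nonneg _).trans h

/-- Uniform decay, read through the window kernel: every `windowKernel (P t) μ ν` obeys b03's `Decay510 C δ`. [folklore] -/
theorem UniformDecay.decay510 (hdec : UniformDecay side P C δ) (t : ℕ) (μ ν : Fin d) :
    B12Sec2to5.Decay510 (windowKernel (P t) μ ν) C δ :=
  decay510_windowKernel (hdec.nonneg μ ν) (hdec t μ ν)

omit [∀ t, NeZero (side t)] in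
/-- Exhaustion: along sides `side t → ∞`, every fixed `y ∈ ℤ^d` is eventually inside the window cube. [folklore] -/
theorem eventually_inWindow (hside : Tendsto side atTop atTop) (y : Fin d → ℤ) :
    ∀ᶠ t in atTop, ∀ i, InWindow (side t) (y i) := by
  refine eventually_all.mpr fun i => ?_
  filter_upwards [hside.eventually_gt_atTop (2 * |y i|).toNat] with t ht
  apply inWindow_of_two_mul_abs_lt
  have h₁ : 2 * |y i| ≤ ((2 * |y i|).toNat : ℤ) := Int.self_le_toNat _
  have h₂ : ((2 * |y i|).toNat : ℤ) < (side t : ℤ) := by exact_mod_cast ht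
  exact lt_of_le_of_lt h₁ h₂

/-- Pointwise convergence survives the zero extension: `windowKernel (P t) μ ν y → Pinf μ ν y` (the two sequences agree
for `t` large, by exhaustion). [folklore] -/
theorem tendsto_windowKernel (hside : Tendsto side atTop atTop) (hlim : IsInfiniteVolumeLimit side P Pinf)
    (μ ν : Fin d) (y : Fin d → ℤ) :
    Tendsto (fun t => windowKernel (P t) μ ν y) atTop (𝓝 (Pinf μ ν y)) := by
  refine Tendsto.congr' ?_ (hlim μ ν y)
  filter_upwards [eventually_inWindow hside y] with t ht
  show P t μ ν (fun i => (y i : ZMod (side t))) = windowExt (P t μ ν) y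
  rw [windowExt_of_inWindow _ ht]
  rfl

/-- **(ii-a) The limit kernel inherits (5.10) with the same constants** (closedness of `≤` under pointwise limits).
[folklore] -/
theorem decay510_of_isInfiniteVolumeLimit (hside : Tendsto side atTop atTop)
    (hlim : IsInfiniteVolumeLimit side P Pinf) (hdec : UniformDecay side P C δ) (μ ν : Fin d) :
    B12Sec2to5.Decay510 (Pinf μ ν) C δ := fun y =>
  le_of_tendsto' (tendsto_windowKernel hside hlim μ ν y).abs fun t => hdec.decay510 t μ ν y

/-- **(ii-b) THE LIMIT `T ↗ ℤ^d` OF THE SECOND MOMENTS** (the content of "Now we take a limit of these functions as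
T^{(j+1)} ↗ Z^d" between (1.21) and (1.22), p. 264, for the β-functional): if the torus kernels converge pointwise to
`Pinf`, the sides tend to infinity, and the torus kernels obey (5.10)-type decay UNIFORMLY in the volume, then
`Σ_{x∈T_t} P_t(x) x̂_μ x̂_ν → Σ_{x∈ℤ^d} Pinf(x) x_μ x_ν`.  Proof: Tannery's theorem (dominated convergence for series) with
b03's summable majorant `C·|x|₁²e^{−δ|x|₁}`. [folklore] -/
theorem tendsto_torusSecondMoment (hside : Tendsto side atTop atTop) (hlim : IsInfiniteVolumeLimit side P Pinf)
    (hδ : 0 < δ) (hdec : UniformDecay side P C δ) (μ ν : Fin d) :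
    Tendsto (fun t => torusSecondMoment (P t) μ ν) atTop (𝓝 (B12Beta.secondMoment Pinf μ ν)) := by
  have key : Tendsto (fun t => ∑' y : Fin d → ℤ, windowKernel (P t) μ ν y * (y μ : ℝ) * (y ν : ℝ)) atTop
      (𝓝 (∑' y : Fin d → ℤ, Pinf μ ν y * (y μ : ℝ) * (y ν : ℝ))) := by
    refine tendsto_tsum_of_dominated_convergence
      (f := fun t (y : Fin d → ℤ) => windowKernel (P t) μ ν y * (y μ : ℝ) * (y ν : ℝ))
      ((B12Sec2to5.majorant_summable hδ d).mul_left C) (fun y => ?_) (Eventually.of_forall fun t y => ?_)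
    · exact ((tendsto_windowKernel hside hlim μ ν y).mul_const _).mul_const _
    · rw [Real.norm_eq_abs]
      exact B12Sec2to5.abs_term_le_of_decay510 (hdec.decay510 t μ ν) μ ν y
  have hfun : (fun t => torusSecondMoment (P t) μ ν) =
      fun t => ∑' y : Fin d → ℤ, windowKernel (P t) μ ν y * (y μ : ℝ) * (y ν : ℝ) :=
    funext fun t => torusSecondMoment_eq_tsum (P t) μ ν
  rw [hfun]
  exact key

/-- (ii-c) The (1.22) second moment of the limit kernel converges absolutely and is bounded by b03's `betaPrime510 d C δ`
(= the §5 bound, now for the limit of the torus kernels). [folklore] -/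
theorem abs_secondMoment_lim_le (hside : Tendsto side atTop atTop) (hlim : IsInfiniteVolumeLimit side P Pinf)
    (hδ : 0 < δ) (hdec : UniformDecay side P C δ) (μ ν : Fin d) :
    Summable (fun x : Fin d → ℤ => Pinf μ ν x * (x μ : ℝ) * (x ν : ℝ)) ∧
      |B12Beta.secondMoment Pinf μ ν| ≤ B12Sec2to5.betaPrime510 d C δ :=
  B12Sec2to5.secondMoment_abs_le_of_decay510 hδ (decay510_of_isInfiniteVolumeLimit hside hlim hdec μ ν)

/-- (ii-d) CLOSED CONDITIONS PASS TO THE LIMIT: a lower bound `q ≤ Σ_{x∈T_t} P_t x̂_μ x̂_ν` valid for all sufficiently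
large tori is a lower bound for the (1.22) second moment of the limit kernel (and likewise for upper bounds, by
`tendsto_torusSecondMoment` and `le_of_tendsto`).  This is the logical shape in which finite-volume information reaches
(AF-0s); a bound from ONE torus needs a convergence RATE (sibling node, unit pv04 gen 3). [folklore] -/
theorem le_secondMoment_lim_of_eventually (hside : Tendsto side atTop atTop)
    (hlim : IsInfiniteVolumeLimit side P Pinf) (hδ : 0 < δ) (hdec : UniformDecay side P C δ) (μ ν : Fin d)
    {q : ℝ} (hq : ∀ᶠ t in atTop, q ≤ torusSecondMoment (P t) μ ν) :
    q ≤ B12Beta.secondMoment Pinf μ ν :=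
  ge_of_tendsto (tendsto_torusSecondMoment hside hlim hδ hdec μ ν) hq

/-- (ii-d′) … and an eventual upper bound passes to the limit. [folklore] -/
theorem secondMoment_lim_le_of_eventually (hside : Tendsto side atTop atTop)
    (hlim : IsInfiniteVolumeLimit side P Pinf) (hδ : 0 < δ) (hdec : UniformDecay side P C δ) (μ ν : Fin d)
    {q : ℝ} (hq : ∀ᶠ t in atTop, torusSecondMoment (P t) μ ν ≤ q) :
    B12Beta.secondMoment Pinf μ ν ≤ q :=
  le_of_tendsto (tendsto_torusSecondMoment hside hlim hδ hdec μ ν) hq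

end Limit

/-! ## Part 3 — the corollary over pv25's `OneLoopDictionary` ((1.21)/(1.22) for the one-loop part) -/

section Dictionary

variable {d c : ℕ} {β : (k : ℕ) → (Fin (k + 1) → ℝ) → ℝ} {S : B12Beta.OneLoopSplit β}

/-- The torus sides of a dictionary are nonzero — registered as an instance so that `torusKernel (D.model k t)`,
`torusBetaZero (D.model k t)` elaborate without `@` (`NeZero` is a `Prop`: this instance is definitionally the one
written inline in the fields of `OneLoopDictionary`). [folklore] -/
instance OneLoopDictionary.instNeZeroSide (D : OneLoopDictionary d c S) (k t : ℕ) : NeZero (D.side k t) :=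
  ⟨(D.side_pos k t).ne'⟩

/-- The dictionary's field `isLimit`, restated with the registered instance. [folklore] -/
theorem OneLoopDictionary.isLimit' (D : OneLoopDictionary d c S) (k : ℕ) (a : Fin c) :
    IsInfiniteVolumeLimit (D.side k) (fun t => torusKernel (D.model k t) a) (D.limKernel k) :=
  D.isLimit k a

/-- **(iv) ROW num's OBSERVABLE CONVERGES TO THE ONE-LOOP COEFFICIENT.**  For a dictionary `D` (pv25's hypothesis
carrier: (1.21) `isLimit`, (1.22) `beta0_eq`), a scale `k` with torus sides `D.side k t → ∞`, and volume-uniform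
(5.10)-type decay of the torus one-loop kernels at a colour `a` (the located unprinted input, `UniformDecay`), the
finite-volume one-loop numbers `β⁰_T = Σ_{x∈T} Π⁰_{T,μν}(x) x̂_μ x̂_ν` (`torusBetaZero`, `μ ≠ ν`) converge to `S.β0 k`.
Nothing about Bałaban's kernels is asserted; regularity (`D.smooth`) and the coordinate convention stay with the
instance builder (referee G-beta-7). [folklore] -/
theorem OneLoopDictionary.tendsto_torusBetaZero (D : OneLoopDictionary d c S) (k : ℕ) (a : Fin c)
    (hside : Tendsto (D.side k) atTop atTop) {C δ : ℝ} (hδ : 0 < δ)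
    (hdec : UniformDecay (D.side k) (fun t => torusKernel (D.model k t) a) C δ) {μ ν : Fin d} (hμν : μ ≠ ν) :
    Tendsto (fun t => torusBetaZero (D.model k t) a μ ν) atTop (𝓝 (S.β0 k)) := by
  rw [D.beta0_eq k μ ν hμν]
  exact tendsto_torusSecondMoment hside (D.isLimit' k a) hδ hdec μ ν

/-- (iv-b) Under the same hypotheses the infinite-volume one-loop kernel `D.limKernel k` obeys (5.10) with the torus
constants, and `|S.β0 k| ≤ β′ = betaPrime510 d C δ` — the §5-type bound for the one-loop coefficient, obtained from
FINITE-VOLUME decay data. [folklore] -/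
theorem OneLoopDictionary.abs_beta0_le (D : OneLoopDictionary d c S) (k : ℕ) (a : Fin c)
    (hside : Tendsto (D.side k) atTop atTop) {C δ : ℝ} (hδ : 0 < δ)
    (hdec : UniformDecay (D.side k) (fun t => torusKernel (D.model k t) a) C δ) {μ ν : Fin d} (hμν : μ ≠ ν) :
    B12Sec2to5.Decay510 (D.limKernel k μ ν) C δ ∧ |S.β0 k| ≤ B12Sec2to5.betaPrime510 d C δ := by
  refine ⟨decay510_of_isInfiniteVolumeLimit hside (D.isLimit' k a) hdec μ ν, ?_⟩
  rw [D.beta0_eq k μ ν hμν]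
  exact (abs_secondMoment_lim_le hside (D.isLimit' k a) hδ hdec μ ν).2

/-- (iv-c) THE SHAPE OF (AF-0s) FROM TORI: a lower bound `q ≤ β⁰_T` holding on all sufficiently large tori of scale `k`
is a lower bound `q ≤ S.β0 k` — e.g. with `q = 3β⁰_∞/4` this is one entry of the finite list
`∀ k < k₀, 3·binf/4 ≤ S.β0 k` consumed by `FlowStepRuns.betaLowerH_of_limitSplit`.  (From a SINGLE torus one needs a
rate: sibling node, unit pv04 gen 3.) [folklore] -/
theorem OneLoopDictionary.le_beta0_of_eventually (D : OneLoopDictionary d c S) (k : ℕ) (a : Fin c)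
    (hside : Tendsto (D.side k) atTop atTop) {C δ : ℝ} (hδ : 0 < δ)
    (hdec : UniformDecay (D.side k) (fun t => torusKernel (D.model k t) a) C δ) {μ ν : Fin d} (hμν : μ ≠ ν)
    {q : ℝ} (hq : ∀ᶠ t in atTop, q ≤ torusBetaZero (D.model k t) a μ ν) : q ≤ S.β0 k := by
  rw [D.beta0_eq k μ ν hμν]
  exact le_secondMoment_lim_of_eventually hside (D.isLimit' k a) hδ hdec μ ν hq

end Dictionary

end Literature.MathematicalPhysics.QuantumFieldTheory.Balaban1983to89.Beta
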